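import Summits.FinalStateConjecture.FinalStateConjecture.Theorems.ClusterCompletenessOmegaLimitMultiKerrTranslateCompactness
import HarnessLib

/-!
# Route ClusterCompleteness · crux `OmegaLimitMultiKerr` — tame limits are regular:
# no junk ω-limits of the late-time translates

Structure lemma for the crux stmt-FinalStateConjecture-14664 (`ClusterCompleteness.OmegaLimitMultiKerr`,
rank 9), line `Sketch`. In the LaSalle reading of the crux the convergence of the TRANSLATES
`x ↦ h (x + t • e)` of a chart field `h` (`C^{k+1}` on an open set `O` invariant under translation by
`e`) is measured by `supCkENorm K m (…) → 0` on compacts `K ⊆ O`. The sup norm `supCkENorm` is built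
on Mathlib's `iteratedFDeriv`, which is junk (zero) where the function is not differentiable, so
"the translates converge to `g` in `supCkENorm K m`" does not by itself make `g` regular. This file
removes the loophole under TAMENESS:

**Theorem (`contDiffOn_of_tendsto_supCkENorm_translate_sub`).** If `h` has all-late-time `C^{k+1}`
bounds on the translates of every compact `K ⊆ O`, then ANY field `g` to which the translates
`h (· + T n • e)` (`T n → ∞`) converge in ANY `supCkENorm K m` on compacts (in particular `m = 0`:
uniformly on compacts) is of class `Cᵏ` on `O`.

Proof: the order-zero term of `supCkENorm` gives pointwise convergence `h (x + T n • e) → g x` on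
`O`; the `Cᵏ` Arzelà–Ascoli theorem for translates
(`exists_strictMono_tendsto_supCkENorm_translate_sub`) gives a subsequence converging in `Cᵏ_loc`
(hence pointwise) to a `Cᵏ` field `g''`; uniqueness of limits identifies `g = g''` on `O`, and
`ContDiffOn.congr` transfers the regularity. Hale 1980, Ch. I, §8 (ω-limit sets of precompact
orbits); Petersen 2006, Ch. 10, §3.1 (`Cᵏ` Arzelà–Ascoli).
-/

-- every `Summit.FinalStateConjecture.FinalStateConjecture.…` name repeats the summit = sub-problem segment (D-0017 layout)
set_option linter.dupNamespace false

noncomputable section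

open Set Filter Topology Function
open scoped ContDiff Topology ENNReal

namespace Summit.FinalStateConjecture.FinalStateConjecture.Theorems.ClusterCompleteness

open Literature.Geometry.Lorentzian

/-- **Tame limits are regular (no junk ω-limits).** Let `O` be open and invariant under all
translations `x ↦ x + s • e`, `h` of class `C^{k+1}` on `O` with all-late-time `C^{k+1}` bounds on
the translates of every compact `K ⊆ O`, and `T n → ∞`. If the translates `h (· + T n • e)` converge
to `g` in `supCkENorm K m` on every compact `K ⊆ O` (any order `m`, e.g. `m = 0`), then `g` is of
class `Cᵏ` on `O`: by the `Cᵏ` Arzelà–Ascoli theorem for translates a subsequence converges in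
`Cᵏ_loc` to a `Cᵏ` field, which agrees with `g` on `O` by uniqueness of pointwise limits
(Hale 1980, Ch. I, §8: ω-limit sets of precompact orbits; Petersen 2006, Ch. 10, §3.1). Stated in
closed form (registered structure stub of the crux stmt-FinalStateConjecture-14664).
[cite: Hale1980, Ch. I §8] -/
theorem contDiffOn_of_tendsto_supCkENorm_translate_sub :
    ∀ {E : Type*} [NormedAddCommGroup E] [NormedSpace ℝ E] [FiniteDimensional ℝ E]
      {W : Type*} [NormedAddCommGroup W] [NormedSpace ℝ W] [FiniteDimensional ℝ W]
      {O : Set E} {e : E}, IsOpen O → (∀ x ∈ O, ∀ s : ℝ, x + s • e ∈ O) →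
      ∀ {k : ℕ} {h : E → W}, ContDiffOn ℝ (k + 1) h O →
      (∀ K ⊆ O, IsCompact K → ∃ Λ a : ℝ, ∀ t : ℝ, a ≤ t → ∀ i, i ≤ k + 1 → ∀ z ∈ K,
        ‖iteratedFDeriv ℝ i h (z + t • e)‖ ≤ Λ) →
      ∀ {g : E → W} {T : ℕ → ℝ} {m : ℕ}, Tendsto T atTop atTop →
      (∀ K ⊆ O, IsCompact K →
        Tendsto (fun n ↦ supCkENorm K m (fun x ↦ h (x + T n • e) - g x)) atTop (𝓝 0)) →
      ContDiffOn ℝ k g O := by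
  intro E _ _ _ W _ _ _ O e hO hOe k h hh htame g T m hT hconv
  -- (1) pointwise convergence on `O` from `supCkENorm`-convergence on compacts (order-zero term)
  have hpt : ∀ {F : ℕ → E → W} {g' : E → W} {m' : ℕ},
      (∀ K ⊆ O, IsCompact K →
        Tendsto (fun n ↦ supCkENorm K m' (fun x ↦ F n x - g' x)) atTop (𝓝 0)) →
      ∀ x ∈ O, Tendsto (fun n ↦ F n x) atTop (𝓝 (g' x)) := by
    intro F g' m' hF x hx
    have h1 := hF {x} (singleton_subset_iff.2 hx) isCompact_singleton
    have h3 : Tendsto (fun n ↦ ‖F n x - g' x‖ₑ) atTop (𝓝 0) := by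
      refine tendsto_of_tendsto_of_tendsto_of_le_of_le tendsto_const_nhds h1
        (fun _ ↦ zero_le) fun n ↦ ?_
      have hle := enorm_iteratedFDeriv_le_supCkENorm (Nat.zero_le m') (mem_singleton x)
        (fun y ↦ F n y - g' y)
      have e0 : ‖iteratedFDeriv ℝ 0 (fun y ↦ F n y - g' y) x‖ₑ = ‖F n x - g' x‖ₑ := by
        rw [enorm_eq_nnnorm, enorm_eq_nnnorm]
        exact congrArg _ (NNReal.eq (by simp only [coe_nnnorm, norm_iteratedFDeriv_zero]))
      exact e0 ▸ hle
    exact tendsto_sub_nhds_zero_iff.1 (tendsto_zero_iff_enorm_tendsto_zero.2 h3)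
  -- (2) nonnegative times `T' n = max (T n) 0`, eventually equal to `T n`
  set T' : ℕ → ℝ := fun n ↦ max (T n) 0 with hT'def
  have hT'0 : ∀ n, 0 ≤ T' n := fun n ↦ le_max_right _ _
  have hT'T : ∀ᶠ n in atTop, T' n = T n := by
    filter_upwards [hT.eventually_ge_atTop 0] with n hn
    exact max_eq_left hn
  have hT' : Tendsto T' atTop atTop := tendsto_atTop_mono (fun n ↦ le_max_left _ _) hT
  -- eventual uniform `C^{k+1}` bounds on the translates of compacts, from tameness
  have hb : ∀ K ⊆ O, IsCompact K → ∃ Λ : ℝ, ∀ᶠ n in atTop, ∀ i, i ≤ k + 1 → ∀ z ∈ K,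
      ‖iteratedFDeriv ℝ i h (z + T' n • e)‖ ≤ Λ := by
    intro K hKO hK
    obtain ⟨Λ, a, hΛ⟩ := htame K hKO hK
    refine ⟨Λ, ?_⟩
    filter_upwards [hT'.eventually_ge_atTop a] with n hn
    exact hΛ (T' n) hn
  have hOe' : ∀ x ∈ O, ∀ s : ℝ, 0 ≤ s → x + s • e ∈ O := fun x hx s _ ↦ hOe x hx s
  -- `Cᵏ` Arzelà–Ascoli for the translates along `T'`
  obtain ⟨g'', φ, hφ, hg'', hlim⟩ :=
    exists_strictMono_tendsto_supCkENorm_translate_sub hO hOe' hh hT'0 hb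
  -- (3) `g = g''` on `O` by uniqueness of pointwise limits along the subsequence `φ`
  have heq : ∀ x ∈ O, g x = g'' x := by
    intro x hx
    have h1 : Tendsto (fun n ↦ h (x + T n • e)) atTop (𝓝 (g x)) := hpt hconv x hx
    have h2 : Tendsto (fun n ↦ h (x + T' (φ n) • e)) atTop (𝓝 (g'' x)) := hpt hlim x hx
    have h1' : Tendsto (fun n ↦ h (x + T' (φ n) • e)) atTop (𝓝 (g x)) := by
      refine (h1.comp hφ.tendsto_atTop).congr' ?_
      filter_upwards [hφ.tendsto_atTop.eventually hT'T] with n hn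
      simp only [Function.comp_apply, hn]
    exact tendsto_nhds_unique h1' h2
  -- (4) transfer the regularity of `g''` to `g`
  exact hg''.congr heq

end Summit.FinalStateConjecture.FinalStateConjecture.Theorems.ClusterCompleteness

end
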